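import Literature.Barriers.AtomisticToContinuum.FPUBetaKineticAnomaly
import Literature.MathematicalPhysics.KineticTheory.LangevinChainGibbs
import Mathlib.Analysis.Calculus.BumpFunction.InnerProduct
import Mathlib.Analysis.SpecialFunctions.Trigonometric.Deriv
import Mathlib.MeasureTheory.Integral.DominatedConvergence
import HarnessLib

/-!
# Unpinned chains have no steady state: `FouriersLawFor` fails whenever `U' ≡ 0` (barrier audit of `FPUBetaKineticAnomaly`, 2026-08-15)

`Literature/Barriers/AtomisticToContinuum/` (D-0021 barrier catalogue), sub-problem `FouriersLaw`.
Companion of `FPUBetaKineticAnomaly.lean` (the kinetic `t^{-3/5}` anomaly of the FPU-`β` chain,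
Lukkarinen–Spohn 2008), written for its barrier audit (refuter, 2026-08-15); the sharpened
BARRIER block that uses this file is `FPUBetaKineticAnomalyNarrow.lean`.

The catalogued block names as its formal target "any method meant to prove
`OscillatorChain.FouriersLawFor` (finite positive `κ`) for the UNPINNED FPU-`β` chain
`fpuBetaChain β γ` (equivalently `pinnedChain 0 0 β γ` up to normalisation)". This file proves,
sorry-free, that this target is FALSE for a reason unrelated to transport. In the tree's encoding
of the Bonetto–Lebowitz–Rey-Bellet setting (`FouriersLaw.lean`: positions in `ℝ^N`, free ends,
Langevin baths acting on the end momenta; a steady state is a probability measure solving the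
stationary Fokker–Planck equation weakly, `∫ L f dμ = 0` for `f ∈ C_c^∞`) a chain whose pinning
exerts no force (`U' ≡ 0`) has NO weak steady state as soon as the baths are on, and several when
they are off, so clause (i) of `FouriersLawFor` (existence AND uniqueness of the steady state for
every `N` and all `T_L, T_R > 0`) fails at `N = 1`:

* `not_isSteadyState_one_of_unpinned` — `U' ≡ 0`, `γ ≠ 0`, `T_L + T_R ≠ 0`: no probability
  measure on the phase space of the one-site chain is a weak steady state;
* `isSteadyState_dirac_of_unpinned` — `U' ≡ 0`, `γ = 0`: every rest point `δ_{(a,0)}` is one;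
* `not_fouriersLawFor_of_unpinned` — hence `¬ P.FouriersLawFor` for EVERY `OscillatorChain`
  with `U' ≡ 0`, whatever `V` and `γ`; in particular `not_fouriersLawFor_fpuBetaChain` (all
  `β, γ`) and `not_fouriersLawFor_pinnedChain_zero_zero` (the conjunct's family
  `pinnedChain ω₂ lam β γ` with the pinning switched off, `ω₂ = lam = 0`).

Mechanism (the free mode). With `U' ≡ 0` the observable `m = γ(q_0 + q_{N-1}) + ∑_i p_i`
(`m = 2γq + p` for `N = 1`) satisfies `L(g ∘ m) = γ(T_L + T_R) g'' ∘ m` for every smooth `g`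
(`generator_one_prodFn` with `ψ ≡ 1`: the pinning force is absent, the interaction forces cancel
in `∑_i ∂_{q_i}H`, and the friction `-γp∂_p` cancels against the transport `p∂_q`): `m` is a
driftless Brownian motion of variance `2γ(T_L + T_R)t` — the centre of mass is not confined, which
is what pinning is for ("the pinning potentials, which prevent it from 'flying away'",
Cuneo–Eckmann–Hairer–Rey-Bellet 2018, §1; their standing condition CA — compact level sets of `H`,
`e^{-βH} ∈ L¹` — fails for `U' ≡ 0`). A stationary law of `m` would be a probability measure `ν`
on `ℝ` with `∫ g'' dν = 0` for all test functions `g`; there is none. The kernel proof (one site: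
no interaction force has to be dominated, so NO hypothesis on `V` is needed) tests stationarity
on `F_{ξ,R}(q, p) = cos(ξm) χ(m/R) χ(p/R)` with a fixed smooth bump `χ`, lets `R → ∞` by
dominated convergence (`|L F_{ξ,R}| ≤ K` uniformly in `x` and `R ≥ 1`,
`L F_{ξ,R} → -γ(T_L + T_R) ξ² cos(ξm)` pointwise) to get `∫ cos(ξ m) dμ = 0` for every `ξ ≠ 0`
(`integral_cos_freeMode_eq_zero`), then `ξ → 0` to get `μ(phase space) = 0 ≠ 1`.

What this says for the catalogue (spelled out in `FPUBetaKineticAnomalyNarrow.lean`): the kinetic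
anomaly is a barrier for a walled / relative-coordinate / Green–Kubo formalisation of "finite
conductivity of the unpinned FPU-`β` chain", none of which exists in the tree; the tree's own
`FouriersLawFor` is refuted outright on every unpinned chain alike (FPU-`β`, Toda, purely harmonic,
…), conducting or not, and the first job of the pinning in the conjunct `FouriersLaw` is confinement
(clause (i)), before any transport mechanism. The informal remark on `rotorChain` in
`AnticontinuumLocalization.lean` (bounded `2π`-periodic `U`, `U' ≢ 0`) is the same phenomenon for a
different reason and is NOT covered by the theorems here.

## Contents

* One-site calculus for `OscillatorChain` (`hamiltonian_one`, `partialQ_hamiltonian_one`,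
  `generator_one`, `partialQ_prodFn`, `partialP_prodFn`, `partialP_partialP_prodFn`) and the
  free-mode identity `generator_one_prodFn`.
* Namespace `Unpinned`: the bump `χ` (`cutoff`, Mathlib's `ContDiffBump` with `rIn = 1`,
  `rOut = 2`), its rescalings and derivative bounds (`derivBound`); the factors
  `φ_{ξ,R}(s) = cos(ξs)χ(s/R)`, `ψ_R(s) = χ(s/R)` with explicit first and second derivatives,
  uniform bounds for `R ≥ 1` and pointwise limits as `R → ∞`; the test functions `testFn`
  (smooth, compactly supported for `γ ≠ 0`), `generator_testFn`, the uniform bound `genBound` and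
  the pointwise limit `tendsto_generator_testFn`.
* The theorems listed above (namespace `Literature.Barriers.AtomisticToContinuum.HeatConduction`).

## Design notes

* Only `N = 1` is formalised: it is the first instance the conjunction `FouriersLawFor` exposes and
  it carries no interaction term, so the theorems hold for every `V : ℝ → ℝ` and every `γ`. For
  `N ≥ 2` the identity `L(g ∘ m) = γ(T_L + T_R)g'' ∘ m`, `m = γ(q_0 + q_{N-1}) + ∑ p_i`, holds
  whenever `V` is differentiable (informal, not needed).
* `U' ≡ 0` is the hypothesis `∀ q, deriv P.U q = 0` (the generator only sees `deriv U`), as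
  `OscillatorChain.not_fouriersLawFor_of_deriv_V` (`FouriersLawProofs.lean`) does for `V`.
* Dominated convergence runs along `Filter.atTop` on `ℝ` (countably generated) for `R → ∞` and
  along `ℕ` (`ξ = 1/(n+1)`) for `ξ → 0`; the dominating functions are constants (`μ` is a
  probability measure).
-/

noncomputable section

open MeasureTheory Filter Topology Set Real
open scoped ContDiff

namespace Literature.Barriers.AtomisticToContinuum.HeatConduction

open Literature.MathematicalPhysics.KineticTheory.HeatConduction

variable (P : OscillatorChain)

/-! ### The one-site chain: Hamiltonian, partial derivatives, generator -/

/-- `H = p²/2 + U(q)` for the one-site chain (no bond). [folklore] -/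
theorem hamiltonian_one (x : PhaseSpace 1) :
    P.hamiltonian 1 x = x.2 0 ^ 2 / 2 + P.U (x.1 0) := by
  simp [OscillatorChain.hamiltonian]

/-- `∂_q H = U'(q)` for the one-site chain. [folklore] -/
theorem partialQ_hamiltonian_one (x : PhaseSpace 1) :
    partialQ 0 (P.hamiltonian 1) x = deriv P.U (x.1 0) := by
  simp only [partialQ, hamiltonian_one, Function.update_self]
  rw [deriv_const_add]

/-- The generator of the one-site chain (both baths act on the single site). [folklore] -/
theorem generator_one (T_L T_R : ℝ) (f : PhaseSpace 1 → ℝ) (x : PhaseSpace 1) :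
    P.generator 1 T_L T_R f x =
      x.2 0 * partialQ 0 f x - partialQ 0 (P.hamiltonian 1) x * partialP 0 f x +
        P.γ * ((T_L * partialP 0 (partialP 0 f) x - x.2 0 * partialP 0 f x) +
          (T_R * partialP 0 (partialP 0 f) x - x.2 0 * partialP 0 f x)) := by
  simp [OscillatorChain.generator]

/-- `∂_q [φ(cq + p) ψ(p)] = c φ'(cq + p) ψ(p)`. [folklore] -/
theorem partialQ_prodFn {φ : ℝ → ℝ} (ψ : ℝ → ℝ) (hφ : Differentiable ℝ φ) (c : ℝ)
    (x : PhaseSpace 1) :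
    partialQ 0 (fun y : PhaseSpace 1 => φ (c * y.1 0 + y.2 0) * ψ (y.2 0)) x =
      c * deriv φ (c * x.1 0 + x.2 0) * ψ (x.2 0) := by
  simp only [partialQ, Function.update_self]
  have h1 : HasDerivAt (fun t : ℝ => c * t + x.2 0) c (x.1 0) := by
    simpa using ((hasDerivAt_id (x.1 0)).const_mul c).add_const (x.2 0)
  have h2 : HasDerivAt (fun t : ℝ => φ (c * t + x.2 0)) (deriv φ (c * x.1 0 + x.2 0) * c) (x.1 0) :=
    (hφ (c * x.1 0 + x.2 0)).hasDerivAt.comp (x.1 0) h1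
  rw [(h2.mul_const (ψ (x.2 0))).deriv]
  ring

/-- `∂_p [φ₁(cq + p) ψ₁(p) + φ₂(cq + p) ψ₂(p)]` by the product rule. [folklore] -/
theorem partialP_sumProdFn {φ₁ ψ₁ φ₂ ψ₂ : ℝ → ℝ} (hφ₁ : Differentiable ℝ φ₁)
    (hψ₁ : Differentiable ℝ ψ₁) (hφ₂ : Differentiable ℝ φ₂) (hψ₂ : Differentiable ℝ ψ₂) (c : ℝ)
    (x : PhaseSpace 1) :
    partialP 0 (fun y : PhaseSpace 1 =>
        φ₁ (c * y.1 0 + y.2 0) * ψ₁ (y.2 0) + φ₂ (c * y.1 0 + y.2 0) * ψ₂ (y.2 0)) x =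
      (deriv φ₁ (c * x.1 0 + x.2 0) * ψ₁ (x.2 0) + φ₁ (c * x.1 0 + x.2 0) * deriv ψ₁ (x.2 0)) +
        (deriv φ₂ (c * x.1 0 + x.2 0) * ψ₂ (x.2 0) +
          φ₂ (c * x.1 0 + x.2 0) * deriv ψ₂ (x.2 0)) := by
  simp only [partialP, Function.update_self]
  have h1 : HasDerivAt (fun t : ℝ => c * x.1 0 + t) 1 (x.2 0) := by
    simpa using (hasDerivAt_id (x.2 0)).const_add (c * x.1 0)
  have hA : ∀ {φ ψ : ℝ → ℝ}, Differentiable ℝ φ → Differentiable ℝ ψ →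
      HasDerivAt (fun t : ℝ => φ (c * x.1 0 + t) * ψ t)
        (deriv φ (c * x.1 0 + x.2 0) * ψ (x.2 0) + φ (c * x.1 0 + x.2 0) * deriv ψ (x.2 0))
        (x.2 0) := by
    intro φ ψ hφ hψ
    have h2 : HasDerivAt (fun t : ℝ => φ (c * x.1 0 + t)) (deriv φ (c * x.1 0 + x.2 0) * 1)
        (x.2 0) := (hφ (c * x.1 0 + x.2 0)).hasDerivAt.comp (x.2 0) h1
    have h3 : HasDerivAt (fun t : ℝ => φ (c * x.1 0 + t) * ψ t)
        (deriv φ (c * x.1 0 + x.2 0) * 1 * ψ (x.2 0) + φ (c * x.1 0 + x.2 0) * deriv ψ (x.2 0))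
        (x.2 0) := h2.mul (hψ (x.2 0)).hasDerivAt
    exact h3.congr_deriv (by ring)
  exact ((hA hφ₁ hψ₁).add (hA hφ₂ hψ₂)).deriv

/-- `∂_p [φ(cq + p) ψ(p)] = φ'ψ + φψ'`. [folklore] -/
theorem partialP_prodFn {φ ψ : ℝ → ℝ} (hφ : Differentiable ℝ φ) (hψ : Differentiable ℝ ψ)
    (c : ℝ) (x : PhaseSpace 1) :
    partialP 0 (fun y : PhaseSpace 1 => φ (c * y.1 0 + y.2 0) * ψ (y.2 0)) x =
      deriv φ (c * x.1 0 + x.2 0) * ψ (x.2 0) + φ (c * x.1 0 + x.2 0) * deriv ψ (x.2 0) := by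
  have h := partialP_sumProdFn hφ hψ (differentiable_const (0 : ℝ)) hψ c x
  simp only [zero_mul, add_zero, deriv_const'] at h
  simpa using h

/-- `∂_p² [φ(cq + p) ψ(p)] = φ''ψ + 2φ'ψ' + φψ''`. [folklore] -/
theorem partialP_partialP_prodFn {φ ψ : ℝ → ℝ} (hφ : ContDiff ℝ ∞ φ) (hψ : ContDiff ℝ ∞ ψ)
    (c : ℝ) (x : PhaseSpace 1) :
    partialP 0 (partialP 0 (fun y : PhaseSpace 1 => φ (c * y.1 0 + y.2 0) * ψ (y.2 0))) x =
      deriv (deriv φ) (c * x.1 0 + x.2 0) * ψ (x.2 0) +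
        2 * (deriv φ (c * x.1 0 + x.2 0) * deriv ψ (x.2 0)) +
          φ (c * x.1 0 + x.2 0) * deriv (deriv ψ) (x.2 0) := by
  have hφd : Differentiable ℝ φ := hφ.differentiable (by simp)
  have hψd : Differentiable ℝ ψ := hψ.differentiable (by simp)
  have hφ' : Differentiable ℝ (deriv φ) :=
    (contDiff_infty_iff_deriv.mp hφ).2.differentiable (by simp)
  have hψ' : Differentiable ℝ (deriv ψ) :=
    (contDiff_infty_iff_deriv.mp hψ).2.differentiable (by simp)
  have hfun : partialP 0 (fun y : PhaseSpace 1 => φ (c * y.1 0 + y.2 0) * ψ (y.2 0)) =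
      fun y : PhaseSpace 1 => deriv φ (c * y.1 0 + y.2 0) * ψ (y.2 0) +
        φ (c * y.1 0 + y.2 0) * deriv ψ (y.2 0) := by
    funext y; exact partialP_prodFn hφd hψd c y
  rw [hfun, partialP_sumProdFn hφ' hψd hφd hψ' c x]
  ring

/-- **The free mode of an unpinned one-site chain.** If the pinning exerts no force (`U' ≡ 0`)
then for every test function of the product form `F(q, p) = φ(2γq + p) ψ(p)` the generator is
`L F = γ(T_L + T_R)(φ''ψ + 2φ'ψ' + φψ'')(2γq + p, p) - 2γ p φ(2γq + p) ψ'(p)`: on functions of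
`m = 2γq + p` alone (`ψ ≡ 1`) it acts as the one-dimensional Laplacian `γ(T_L + T_R) ∂_m²` — the
observable `m` is a driftless Brownian motion, the centre of mass is not confined. [folklore] -/
theorem generator_one_prodFn (hU : ∀ q, deriv P.U q = 0) {φ ψ : ℝ → ℝ} (hφ : ContDiff ℝ ∞ φ)
    (hψ : ContDiff ℝ ∞ ψ) (T_L T_R : ℝ) (x : PhaseSpace 1) :
    P.generator 1 T_L T_R (fun y : PhaseSpace 1 => φ (2 * P.γ * y.1 0 + y.2 0) * ψ (y.2 0)) x =
      P.γ * (T_L + T_R) *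
          (deriv (deriv φ) (2 * P.γ * x.1 0 + x.2 0) * ψ (x.2 0) +
            2 * (deriv φ (2 * P.γ * x.1 0 + x.2 0) * deriv ψ (x.2 0)) +
              φ (2 * P.γ * x.1 0 + x.2 0) * deriv (deriv ψ) (x.2 0)) -
        2 * P.γ * x.2 0 * (φ (2 * P.γ * x.1 0 + x.2 0) * deriv ψ (x.2 0)) := by
  have hφd : Differentiable ℝ φ := hφ.differentiable (by simp)
  have hψd : Differentiable ℝ ψ := hψ.differentiable (by simp)
  rw [generator_one, partialQ_hamiltonian_one, hU, partialQ_prodFn ψ hφd,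
    partialP_prodFn hφd hψd, partialP_partialP_prodFn hφ hψ]
  ring

namespace Unpinned

/-! ### A fixed smooth cutoff and its rescalings -/

/-- A smooth bump on `ℝ`: `1` on `[-1, 1]`, supported in `[-2, 2]`, values in `[0, 1]`. [folklore] -/
def bump : ContDiffBump (0 : ℝ) := ⟨1, 2, one_pos, by norm_num⟩

/-- The cutoff `χ = bump` as a real function. [folklore] -/
def cutoff (s : ℝ) : ℝ := (bump : ℝ → ℝ) s

/-- `χ` is `C^n` for every `n`. [folklore] -/
theorem cutoff_contDiff {n : ℕ∞} : ContDiff ℝ n cutoff := bump.contDiff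

/-- `χ` is smooth. [folklore] -/
theorem cutoff_smooth : ContDiff ℝ ∞ cutoff := cutoff_contDiff

/-- `χ(0) = 1`. [folklore] -/
theorem cutoff_zero : cutoff 0 = 1 :=
  bump.one_of_mem_closedBall (by simp [bump])

/-- `|χ| ≤ 1`. [folklore] -/
theorem abs_cutoff_le (s : ℝ) : |cutoff s| ≤ 1 := by
  unfold cutoff; rw [abs_of_nonneg bump.nonneg]; exact bump.le_one

/-- `χ(s) = 0` for `|s| ≥ 2`. [folklore] -/
theorem cutoff_eq_zero {s : ℝ} (hs : 2 ≤ |s|) : cutoff s = 0 :=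
  bump.zero_of_le_dist (by simpa [bump, Real.dist_eq] using hs)

/-- `χ` has compact support. [folklore] -/
theorem hasCompactSupport_cutoff : HasCompactSupport cutoff := bump.hasCompactSupport

/-- `tsupport χ = [-2, 2]`. [folklore] -/
theorem tsupport_cutoff : tsupport cutoff = Metric.closedBall (0 : ℝ) 2 := bump.tsupport_eq

/-- `χ` is continuous. [folklore] -/
theorem continuous_cutoff : Continuous cutoff := cutoff_smooth.continuous

/-- `χ` is differentiable. [folklore] -/
theorem differentiable_cutoff : Differentiable ℝ cutoff := cutoff_smooth.differentiable (by simp)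

/-- `χ'` is smooth. [folklore] -/
theorem cutoff_deriv_smooth : ContDiff ℝ ∞ (deriv cutoff) := (contDiff_infty_iff_deriv.mp cutoff_smooth).2

/-- `χ'` is continuous. [folklore] -/
theorem continuous_deriv_cutoff : Continuous (deriv cutoff) := cutoff_deriv_smooth.continuous

/-- `χ'` is differentiable. [folklore] -/
theorem differentiable_deriv_cutoff : Differentiable ℝ (deriv cutoff) :=
  cutoff_deriv_smooth.differentiable (by simp)

/-- `χ''` is continuous. [folklore] -/
theorem continuous_deriv_deriv_cutoff : Continuous (deriv (deriv cutoff)) :=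
  (contDiff_infty_iff_deriv.mp cutoff_deriv_smooth).2.continuous

/-- `χ'` vanishes outside `[-2, 2]`. [folklore] -/
theorem deriv_cutoff_eq_zero {s : ℝ} (hs : 2 < |s|) : deriv cutoff s = 0 := by
  by_contra h
  have hmem : s ∈ tsupport cutoff := support_deriv_subset (Function.mem_support.mpr h)
  rw [tsupport_cutoff, Metric.mem_closedBall, Real.dist_eq, sub_zero] at hmem
  linarith

/-- Uniform bounds `|χ'| ≤ C₁`, `|χ''| ≤ C₂`. [folklore] -/
theorem exists_bound_deriv_cutoff : ∃ C : ℝ, 0 ≤ C ∧ (∀ s, |deriv cutoff s| ≤ C) ∧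
    ∀ s, |deriv (deriv cutoff) s| ≤ C := by
  obtain ⟨C₁, hC₁⟩ := hasCompactSupport_cutoff.deriv.exists_bound_of_continuous continuous_deriv_cutoff
  obtain ⟨C₂, hC₂⟩ :=
    hasCompactSupport_cutoff.deriv.deriv.exists_bound_of_continuous continuous_deriv_deriv_cutoff
  refine ⟨max C₁ C₂, ?_, fun s => ?_, fun s => ?_⟩
  · exact le_trans (le_trans (norm_nonneg _) (hC₁ 0)) (le_max_left _ _)
  · exact le_trans (by simpa [Real.norm_eq_abs] using hC₁ s) (le_max_left _ _)
  · exact le_trans (by simpa [Real.norm_eq_abs] using hC₂ s) (le_max_right _ _)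

/-- `d/ds χ(s/R) = χ'(s/R)/R`. [folklore] -/
theorem hasDerivAt_cutoff_div (R s : ℝ) :
    HasDerivAt (fun s => cutoff (s / R)) (deriv cutoff (s / R) / R) s := by
  have h1 : HasDerivAt (fun s : ℝ => s / R) (1 / R) s := by
    simpa using (hasDerivAt_id s).div_const R
  have h2 : HasDerivAt (fun s => cutoff (s / R)) (deriv cutoff (s / R) * (1 / R)) s :=
    (differentiable_cutoff (s / R)).hasDerivAt.comp s h1
  exact h2.congr_deriv (by ring)

/-- `(χ(·/R))' = χ'(·/R)/R`. [folklore] -/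
theorem deriv_cutoff_div (R : ℝ) :
    deriv (fun s => cutoff (s / R)) = fun s => deriv cutoff (s / R) / R := by
  funext s; exact (hasDerivAt_cutoff_div R s).deriv

/-- `(χ(·/R))'' = χ''(·/R)/R²`. [folklore] -/
theorem deriv_deriv_cutoff_div (R : ℝ) :
    deriv (deriv (fun s => cutoff (s / R))) = fun s => deriv (deriv cutoff) (s / R) / R ^ 2 := by
  rw [deriv_cutoff_div]
  funext s
  have h1 : HasDerivAt (fun s : ℝ => s / R) (1 / R) s := by
    simpa using (hasDerivAt_id s).div_const R
  have h0 : HasDerivAt (deriv cutoff) (deriv (deriv cutoff) (s / R)) (s / R) :=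
    (differentiable_deriv_cutoff (s / R)).hasDerivAt
  have h2 := HasDerivAt.comp s h0 h1
  have h3 : HasDerivAt (fun s => deriv cutoff (s / R) / R)
      (deriv (deriv cutoff) (s / R) * (1 / R) / R) s := h2.div_const R
  rw [h3.deriv]; ring

/-- `χ(·/R)` is `C^n`. [folklore] -/
theorem contDiff_cutoff_div (R : ℝ) {n : ℕ∞} : ContDiff ℝ n (fun s => cutoff (s / R)) :=
  cutoff_contDiff.comp (contDiff_id.div_const R)


/-- A uniform bound for `χ'` and `χ''` (a fixed choice). [folklore] -/
def derivBound : ℝ := Classical.choose exists_bound_deriv_cutoff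

/-- `0 ≤ C` for the derivative bound `C`. [folklore] -/
theorem derivBound_nonneg : 0 ≤ derivBound := (Classical.choose_spec exists_bound_deriv_cutoff).1

/-- `|χ'| ≤ C`. [folklore] -/
theorem abs_deriv_cutoff_le (s : ℝ) : |deriv cutoff s| ≤ derivBound :=
  (Classical.choose_spec exists_bound_deriv_cutoff).2.1 s

/-- `|χ''| ≤ C`. [folklore] -/
theorem abs_deriv_deriv_cutoff_le (s : ℝ) : |deriv (deriv cutoff) s| ≤ derivBound :=
  (Classical.choose_spec exists_bound_deriv_cutoff).2.2 s

/-! ### The test functions `F_{ξ,R}(q, p) = cos(ξm) χ(m/R) χ(p/R)`, `m = 2γq + p` -/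

/-- `φ_{ξ,R}(s) = cos(ξs) χ(s/R)`. [folklore] -/
def phiR (ξ R s : ℝ) : ℝ := Real.cos (ξ * s) * cutoff (s / R)

/-- `ψ_R(s) = χ(s/R)`. [folklore] -/
def psiR (R s : ℝ) : ℝ := cutoff (s / R)

/-- `ψ_R` is smooth. [folklore] -/
theorem psiR_smooth (R : ℝ) : ContDiff ℝ ∞ (psiR R) := contDiff_cutoff_div R

/-- `s ↦ cos(ξs)` is smooth. [folklore] -/
theorem cosMul_smooth (ξ : ℝ) : ContDiff ℝ ∞ (fun s : ℝ => Real.cos (ξ * s)) :=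
  Real.contDiff_cos.comp (contDiff_const.mul contDiff_id)

/-- `φ_{ξ,R}` is smooth. [folklore] -/
theorem phiR_smooth (ξ R : ℝ) : ContDiff ℝ ∞ (phiR ξ R) :=
  (cosMul_smooth ξ).mul (contDiff_cutoff_div R)

/-- `(cos(ξs))' = -ξ sin(ξs)`. [folklore] -/
theorem hasDerivAt_cosMul (ξ s : ℝ) :
    HasDerivAt (fun s : ℝ => Real.cos (ξ * s)) (-ξ * Real.sin (ξ * s)) s := by
  have h1 : HasDerivAt (fun s : ℝ => ξ * s) ξ s := by simpa using (hasDerivAt_id s).const_mul ξ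
  have h2 := HasDerivAt.comp s (Real.hasDerivAt_cos (ξ * s)) h1
  have h3 : HasDerivAt (fun s : ℝ => Real.cos (ξ * s)) (-Real.sin (ξ * s) * ξ) s := h2
  exact h3.congr_deriv (by ring)

/-- `(sin(ξs))' = ξ cos(ξs)`. [folklore] -/
theorem hasDerivAt_sinMul (ξ s : ℝ) :
    HasDerivAt (fun s : ℝ => Real.sin (ξ * s)) (ξ * Real.cos (ξ * s)) s := by
  have h1 : HasDerivAt (fun s : ℝ => ξ * s) ξ s := by simpa using (hasDerivAt_id s).const_mul ξ
  have h2 := HasDerivAt.comp s (Real.hasDerivAt_sin (ξ * s)) h1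
  have h3 : HasDerivAt (fun s : ℝ => Real.sin (ξ * s)) (Real.cos (ξ * s) * ξ) s := h2
  exact h3.congr_deriv (by ring)

/-- `ψ_R' = χ'(·/R)/R`. [folklore] -/
theorem deriv_psiR (R : ℝ) : deriv (psiR R) = fun s => deriv cutoff (s / R) / R :=
  deriv_cutoff_div R

/-- `ψ_R'' = χ''(·/R)/R²`. [folklore] -/
theorem deriv_deriv_psiR (R : ℝ) :
    deriv (deriv (psiR R)) = fun s => deriv (deriv cutoff) (s / R) / R ^ 2 :=
  deriv_deriv_cutoff_div R

/-- `φ_{ξ,R}' = -ξ sin(ξs) χ(s/R) + cos(ξs) χ'(s/R)/R`. [folklore] -/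
theorem hasDerivAt_phiR (ξ R s : ℝ) :
    HasDerivAt (phiR ξ R)
      (-ξ * Real.sin (ξ * s) * cutoff (s / R) + Real.cos (ξ * s) * (deriv cutoff (s / R) / R)) s :=
  (hasDerivAt_cosMul ξ s).mul (hasDerivAt_cutoff_div R s)

/-- `φ_{ξ,R}'` as a function. [folklore] -/
theorem deriv_phiR (ξ R : ℝ) :
    deriv (phiR ξ R) = fun s =>
      -ξ * Real.sin (ξ * s) * cutoff (s / R) + Real.cos (ξ * s) * (deriv cutoff (s / R) / R) := by
  funext s; exact (hasDerivAt_phiR ξ R s).deriv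

/-- `φ_{ξ,R}'' = -ξ² cos(ξs) χ(s/R) - 2ξ sin(ξs) χ'(s/R)/R + cos(ξs) χ''(s/R)/R²`. [folklore] -/
theorem deriv_deriv_phiR (ξ R : ℝ) :
    deriv (deriv (phiR ξ R)) = fun s =>
      -ξ ^ 2 * Real.cos (ξ * s) * cutoff (s / R) -
          2 * ξ * Real.sin (ξ * s) * (deriv cutoff (s / R) / R) +
        Real.cos (ξ * s) * (deriv (deriv cutoff) (s / R) / R ^ 2) := by
  rw [deriv_phiR]
  funext s
  have hA : HasDerivAt (fun s => -ξ * Real.sin (ξ * s) * cutoff (s / R))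
      (-ξ * (ξ * Real.cos (ξ * s)) * cutoff (s / R) +
        -ξ * Real.sin (ξ * s) * (deriv cutoff (s / R) / R)) s :=
    (((hasDerivAt_sinMul ξ s).const_mul (-ξ))).mul (hasDerivAt_cutoff_div R s)
  have h1 : HasDerivAt (fun s : ℝ => s / R) (1 / R) s := by
    simpa using (hasDerivAt_id s).div_const R
  have h0 : HasDerivAt (deriv cutoff) (deriv (deriv cutoff) (s / R)) (s / R) :=
    (differentiable_deriv_cutoff (s / R)).hasDerivAt
  have h2 := HasDerivAt.comp s h0 h1
  have h3 : HasDerivAt (fun s => deriv cutoff (s / R) / R)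
      (deriv (deriv cutoff) (s / R) * (1 / R) / R) s := h2.div_const R
  have hB : HasDerivAt (fun s => Real.cos (ξ * s) * (deriv cutoff (s / R) / R))
      (-ξ * Real.sin (ξ * s) * (deriv cutoff (s / R) / R) +
        Real.cos (ξ * s) * (deriv (deriv cutoff) (s / R) * (1 / R) / R)) s :=
    (hasDerivAt_cosMul ξ s).mul h3
  have hAB : HasDerivAt
      (fun s => -ξ * Real.sin (ξ * s) * cutoff (s / R) + Real.cos (ξ * s) * (deriv cutoff (s / R) / R))
      (-ξ * (ξ * Real.cos (ξ * s)) * cutoff (s / R) + -ξ * Real.sin (ξ * s) * (deriv cutoff (s / R) / R) +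
        (-ξ * Real.sin (ξ * s) * (deriv cutoff (s / R) / R) +
          Real.cos (ξ * s) * (deriv (deriv cutoff) (s / R) * (1 / R) / R))) s := hA.add hB
  rw [hAB.deriv]
  ring

/-! #### Uniform bounds (`R ≥ 1`) -/

/-- `|a + b| ≤ |a| + |b|` on `ℝ` (via the norm). [folklore] -/
theorem absAdd_le (a b : ℝ) : |a + b| ≤ |a| + |b| := by
  simpa only [Real.norm_eq_abs] using norm_add_le a b

/-- `|a - b| ≤ |a| + |b|` on `ℝ` (via the norm). [folklore] -/
theorem absSub_le (a b : ℝ) : |a - b| ≤ |a| + |b| := by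
  simpa only [Real.norm_eq_abs] using norm_sub_le a b

/-- `|ψ_R| ≤ 1`. [folklore] -/
theorem abs_psiR_le (R s : ℝ) : |psiR R s| ≤ 1 := abs_cutoff_le _

/-- `|φ_{ξ,R}| ≤ 1`. [folklore] -/
theorem abs_phiR_le (ξ R s : ℝ) : |phiR ξ R s| ≤ 1 := by
  unfold phiR
  rw [abs_mul]
  exact mul_le_one₀ (Real.abs_cos_le_one _) (abs_nonneg _) (abs_cutoff_le _)

/-- `|χ'(s/R)/R| ≤ C` for `R ≥ 1`. [folklore] -/
theorem abs_deriv_cutoff_div_le {R : ℝ} (hR : 1 ≤ R) (s : ℝ) :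
    |deriv cutoff (s / R) / R| ≤ derivBound := by
  have hRpos : (0 : ℝ) < R := by linarith
  rw [abs_div, abs_of_pos hRpos]
  calc |deriv cutoff (s / R)| / R ≤ |deriv cutoff (s / R)| / 1 :=
        div_le_div_of_nonneg_left (abs_nonneg _) one_pos hR
    _ ≤ derivBound := by simpa using abs_deriv_cutoff_le (s / R)

/-- `|χ''(s/R)/R²| ≤ C` for `R ≥ 1`. [folklore] -/
theorem abs_deriv_deriv_cutoff_div_le {R : ℝ} (hR : 1 ≤ R) (s : ℝ) :
    |deriv (deriv cutoff) (s / R) / R ^ 2| ≤ derivBound := by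
  have hRpos : (0 : ℝ) < R := by linarith
  have hR2 : (0 : ℝ) < R ^ 2 := by positivity
  rw [abs_div, abs_of_pos hR2]
  have h1 : (1 : ℝ) ≤ R ^ 2 := by nlinarith
  calc |deriv (deriv cutoff) (s / R)| / R ^ 2 ≤ |deriv (deriv cutoff) (s / R)| / 1 :=
        div_le_div_of_nonneg_left (abs_nonneg _) one_pos h1
    _ ≤ derivBound := by simpa using abs_deriv_deriv_cutoff_le (s / R)

/-- `|ψ_R'| ≤ C` for `R ≥ 1`. [folklore] -/
theorem abs_deriv_psiR_le {R : ℝ} (hR : 1 ≤ R) (s : ℝ) : |deriv (psiR R) s| ≤ derivBound := by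
  rw [deriv_psiR]; exact abs_deriv_cutoff_div_le hR s

/-- `|ψ_R''| ≤ C` for `R ≥ 1`. [folklore] -/
theorem abs_deriv_deriv_psiR_le {R : ℝ} (hR : 1 ≤ R) (s : ℝ) :
    |deriv (deriv (psiR R)) s| ≤ derivBound := by
  rw [deriv_deriv_psiR]; exact abs_deriv_deriv_cutoff_div_le hR s

/-- `|p ψ_R'(p)| = |p/R| |χ'(p/R)| ≤ 2 C` (`χ'` vanishes off `[-2, 2]`). [folklore] -/
theorem abs_mul_deriv_psiR_le {R : ℝ} (hR : 1 ≤ R) (s : ℝ) :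
    |s * deriv (psiR R) s| ≤ 2 * derivBound := by
  rw [deriv_psiR]
  have hRpos : 0 < R := by linarith
  have heq : s * (deriv cutoff (s / R) / R) = (s / R) * deriv cutoff (s / R) := by
    field_simp
  rw [heq, abs_mul]
  by_cases h : |s / R| ≤ 2
  · exact mul_le_mul h (abs_deriv_cutoff_le _) (abs_nonneg _) (by norm_num)
  · rw [deriv_cutoff_eq_zero (lt_of_not_ge h)]
    simp [derivBound_nonneg]

/-- `|φ_{ξ,R}'| ≤ |ξ| + C` for `R ≥ 1`. [folklore] -/
theorem abs_deriv_phiR_le (ξ : ℝ) {R : ℝ} (hR : 1 ≤ R) (s : ℝ) :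
    |deriv (phiR ξ R) s| ≤ |ξ| + derivBound := by
  simp only [deriv_phiR]
  refine le_trans (absAdd_le _ _) (add_le_add ?_ ?_)
  · rw [abs_mul, abs_mul, abs_neg]
    calc |ξ| * |Real.sin (ξ * s)| * |cutoff (s / R)| ≤ |ξ| * 1 * 1 := by
          gcongr
          · exact Real.abs_sin_le_one _
          · exact abs_cutoff_le _
      _ = |ξ| := by ring
  · rw [abs_mul]
    calc |Real.cos (ξ * s)| * |deriv cutoff (s / R) / R| ≤ 1 * derivBound := by
          gcongr
          · exact Real.abs_cos_le_one _
          · exact abs_deriv_cutoff_div_le hR s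
      _ = derivBound := one_mul _

/-- `|φ_{ξ,R}''| ≤ ξ² + 2|ξ|C + C` for `R ≥ 1`. [folklore] -/
theorem abs_deriv_deriv_phiR_le (ξ : ℝ) {R : ℝ} (hR : 1 ≤ R) (s : ℝ) :
    |deriv (deriv (phiR ξ R)) s| ≤ ξ ^ 2 + 2 * |ξ| * derivBound + derivBound := by
  simp only [deriv_deriv_phiR]
  refine le_trans (absAdd_le _ _) (add_le_add (le_trans (absSub_le _ _) (add_le_add ?_ ?_)) ?_)
  · rw [abs_mul, abs_mul, abs_neg, abs_pow, sq_abs]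
    calc ξ ^ 2 * |Real.cos (ξ * s)| * |cutoff (s / R)| ≤ ξ ^ 2 * 1 * 1 := by
          gcongr
          · exact Real.abs_cos_le_one _
          · exact abs_cutoff_le _
      _ = ξ ^ 2 := by ring
  · rw [abs_mul, abs_mul, abs_mul, abs_two]
    calc 2 * |ξ| * |Real.sin (ξ * s)| * |deriv cutoff (s / R) / R| ≤ 2 * |ξ| * 1 * derivBound := by
          gcongr
          · exact Real.abs_sin_le_one _
          · exact abs_deriv_cutoff_div_le hR s
      _ = 2 * |ξ| * derivBound := by ring
  · rw [abs_mul]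
    calc |Real.cos (ξ * s)| * |deriv (deriv cutoff) (s / R) / R ^ 2| ≤ 1 * derivBound := by
          gcongr
          · exact Real.abs_cos_le_one _
          · exact abs_deriv_deriv_cutoff_div_le hR s
      _ = derivBound := one_mul _

/-! #### Pointwise limits as `R → ∞` -/

/-- `s/R → 0` as `R → ∞`. [folklore] -/
theorem tendsto_div_atTop_zero (s : ℝ) : Tendsto (fun R : ℝ => s / R) atTop (𝓝 0) :=
  tendsto_const_nhds.div_atTop tendsto_id

/-- `χ(s/R) → 1` as `R → ∞`. [folklore] -/
theorem tendsto_cutoff_div (s : ℝ) : Tendsto (fun R : ℝ => cutoff (s / R)) atTop (𝓝 1) := by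
  rw [← cutoff_zero]
  exact (continuous_cutoff.tendsto 0).comp (tendsto_div_atTop_zero s)

/-- `χ'(s/R)/R → 0` as `R → ∞`. [folklore] -/
theorem tendsto_deriv_cutoff_div (s : ℝ) :
    Tendsto (fun R : ℝ => deriv cutoff (s / R) / R) atTop (𝓝 0) :=
  ((continuous_deriv_cutoff.tendsto 0).comp (tendsto_div_atTop_zero s)).div_atTop tendsto_id

/-- `χ''(s/R)/R² → 0` as `R → ∞`. [folklore] -/
theorem tendsto_deriv_deriv_cutoff_div (s : ℝ) :
    Tendsto (fun R : ℝ => deriv (deriv cutoff) (s / R) / R ^ 2) atTop (𝓝 0) :=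
  ((continuous_deriv_deriv_cutoff.tendsto 0).comp (tendsto_div_atTop_zero s)).div_atTop
    (tendsto_pow_atTop two_ne_zero)

/-- `ψ_R(s) → 1` as `R → ∞`. [folklore] -/
theorem tendsto_psiR (s : ℝ) : Tendsto (fun R : ℝ => psiR R s) atTop (𝓝 1) := tendsto_cutoff_div s

/-- `ψ_R'(s) → 0` as `R → ∞`. [folklore] -/
theorem tendsto_deriv_psiR (s : ℝ) : Tendsto (fun R : ℝ => deriv (psiR R) s) atTop (𝓝 0) := by
  simp only [deriv_psiR]; exact tendsto_deriv_cutoff_div s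

/-- `ψ_R''(s) → 0` as `R → ∞`. [folklore] -/
theorem tendsto_deriv_deriv_psiR (s : ℝ) :
    Tendsto (fun R : ℝ => deriv (deriv (psiR R)) s) atTop (𝓝 0) := by
  simp only [deriv_deriv_psiR]; exact tendsto_deriv_deriv_cutoff_div s

/-- `φ_{ξ,R}(s) → cos(ξs)` as `R → ∞`. [folklore] -/
theorem tendsto_phiR (ξ s : ℝ) : Tendsto (fun R : ℝ => phiR ξ R s) atTop (𝓝 (Real.cos (ξ * s))) := by
  have h := (tendsto_const_nhds (x := Real.cos (ξ * s))).mul (tendsto_cutoff_div s)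
  simpa [phiR] using h

/-- `φ_{ξ,R}'(s) → -ξ sin(ξs)` as `R → ∞`. [folklore] -/
theorem tendsto_deriv_phiR (ξ s : ℝ) :
    Tendsto (fun R : ℝ => deriv (phiR ξ R) s) atTop (𝓝 (-ξ * Real.sin (ξ * s))) := by
  simp only [deriv_phiR]
  have h := ((tendsto_const_nhds (x := -ξ * Real.sin (ξ * s))).mul (tendsto_cutoff_div s)).add
    ((tendsto_const_nhds (x := Real.cos (ξ * s))).mul (tendsto_deriv_cutoff_div s))
  simpa using h

/-- `φ_{ξ,R}''(s) → -ξ² cos(ξs)` as `R → ∞`. [folklore] -/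
theorem tendsto_deriv_deriv_phiR (ξ s : ℝ) :
    Tendsto (fun R : ℝ => deriv (deriv (phiR ξ R)) s) atTop (𝓝 (-ξ ^ 2 * Real.cos (ξ * s))) := by
  simp only [deriv_deriv_phiR]
  have h := (((tendsto_const_nhds (x := -ξ ^ 2 * Real.cos (ξ * s))).mul (tendsto_cutoff_div s)).sub
    ((tendsto_const_nhds (x := 2 * ξ * Real.sin (ξ * s))).mul (tendsto_deriv_cutoff_div s))).add
    ((tendsto_const_nhds (x := Real.cos (ξ * s))).mul (tendsto_deriv_deriv_cutoff_div s))
  simpa using h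

/-- `s ψ_R'(s) → 0` as `R → ∞`. [folklore] -/
theorem tendsto_mul_deriv_psiR (s : ℝ) :
    Tendsto (fun R : ℝ => s * deriv (psiR R) s) atTop (𝓝 0) := by
  simpa using (tendsto_const_nhds (x := s)).mul (tendsto_deriv_psiR s)


/-! #### The test functions on phase space -/

/-- `F_{γ,ξ,R}(q, p) = φ_{ξ,R}(2γq + p) ψ_R(p) = cos(ξm) χ(m/R) χ(p/R)`, `m = 2γq + p`. [folklore] -/
def testFn (γ ξ R : ℝ) (x : PhaseSpace 1) : ℝ :=
  phiR ξ R (2 * γ * x.1 0 + x.2 0) * psiR R (x.2 0)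

/-- The free mode `x ↦ 2γq + p` is smooth on phase space. [folklore] -/
theorem contDiff_freeMode (γ : ℝ) :
    ContDiff ℝ ∞ (fun x : PhaseSpace 1 => 2 * γ * x.1 0 + x.2 0) := by
  have h1 : ContDiff ℝ ∞ (fun x : PhaseSpace 1 => x.1 0) :=
    (contDiff_apply ℝ ℝ (0 : Fin 1)).comp contDiff_fst
  have h2 : ContDiff ℝ ∞ (fun x : PhaseSpace 1 => x.2 0) :=
    (contDiff_apply ℝ ℝ (0 : Fin 1)).comp contDiff_snd
  exact (contDiff_const.mul h1).add h2

/-- The momentum coordinate is smooth on phase space. [folklore] -/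
theorem contDiff_momentum : ContDiff ℝ ∞ (fun x : PhaseSpace 1 => x.2 0) :=
  (contDiff_apply ℝ ℝ (0 : Fin 1)).comp contDiff_snd

/-- The free mode is continuous. [folklore] -/
theorem continuous_freeMode (γ : ℝ) : Continuous (fun x : PhaseSpace 1 => 2 * γ * x.1 0 + x.2 0) :=
  (contDiff_freeMode γ).continuous

/-- The momentum coordinate is continuous. [folklore] -/
theorem continuous_momentum : Continuous (fun x : PhaseSpace 1 => x.2 0) :=
  contDiff_momentum.continuous

/-- The test functions are smooth. [folklore] -/
theorem testFn_smooth (γ ξ R : ℝ) : ContDiff ℝ ∞ (testFn γ ξ R) :=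
  ((phiR_smooth ξ R).comp (contDiff_freeMode γ)).mul ((psiR_smooth R).comp contDiff_momentum)

/-- `F = 0` where `|p/R| ≥ 2`. [folklore] -/
theorem testFn_eq_zero_of_le_momentum {γ ξ R : ℝ} {x : PhaseSpace 1} (h : 2 ≤ |x.2 0 / R|) :
    testFn γ ξ R x = 0 := by
  simp [testFn, psiR, cutoff_eq_zero h]

/-- `F = 0` where `|m/R| ≥ 2`. [folklore] -/
theorem testFn_eq_zero_of_le_freeMode {γ ξ R : ℝ} {x : PhaseSpace 1}
    (h : 2 ≤ |(2 * γ * x.1 0 + x.2 0) / R|) : testFn γ ξ R x = 0 := by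
  simp [testFn, phiR, cutoff_eq_zero h]

/-- The test functions have compact support (`γ ≠ 0`: the cutoffs in `m = 2γq + p` and in `p`
bound `q` as well). [folklore] -/
theorem hasCompactSupport_testFn {γ : ℝ} (hγ : γ ≠ 0) (ξ : ℝ) {R : ℝ} (hR : 0 < R) :
    HasCompactSupport (testFn γ ξ R) := by
  have h2γ : 0 < |2 * γ| := abs_pos.mpr (mul_ne_zero two_ne_zero hγ)
  set ρ : ℝ := 2 * R + 4 * R / |2 * γ| with hρ
  have hρ0 : 0 ≤ ρ := by positivity
  refine HasCompactSupport.intro (isCompact_closedBall (0 : PhaseSpace 1) ρ) ?_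
  intro x hx
  by_contra hne
  apply hx
  have hp : |x.2 0| < 2 * R := by
    have h : |x.2 0 / R| < 2 := lt_of_not_ge fun h => hne (testFn_eq_zero_of_le_momentum h)
    rwa [abs_div, abs_of_pos hR, div_lt_iff₀ hR] at h
  have hm : |2 * γ * x.1 0 + x.2 0| < 2 * R := by
    have h : |(2 * γ * x.1 0 + x.2 0) / R| < 2 :=
      lt_of_not_ge fun h => hne (testFn_eq_zero_of_le_freeMode h)
    rwa [abs_div, abs_of_pos hR, div_lt_iff₀ hR] at h
  have hq : |x.1 0| ≤ 4 * R / |2 * γ| := by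
    rw [le_div_iff₀ h2γ, mul_comm, ← abs_mul]
    have : 2 * γ * x.1 0 = (2 * γ * x.1 0 + x.2 0) - x.2 0 := by ring
    rw [this]
    linarith [absSub_le (2 * γ * x.1 0 + x.2 0) (x.2 0)]
  rw [Metric.mem_closedBall, dist_zero_right, Prod.norm_def, max_le_iff,
    pi_norm_le_iff_of_nonneg hρ0, pi_norm_le_iff_of_nonneg hρ0]
  constructor
  · intro i
    rw [Subsingleton.elim i 0, Real.norm_eq_abs]
    calc |x.1 0| ≤ 4 * R / |2 * γ| := hq
      _ ≤ ρ := by rw [hρ]; linarith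
  · intro i
    rw [Subsingleton.elim i 0, Real.norm_eq_abs]
    calc |x.2 0| ≤ 2 * R := hp.le
      _ ≤ ρ := by rw [hρ]; linarith [div_nonneg (by positivity : (0:ℝ) ≤ 4 * R) h2γ.le]

/-- The generator on the test functions (from `generator_one_prodFn`). [folklore] -/
theorem generator_testFn (hU : ∀ q, deriv P.U q = 0) (ξ R T_L T_R : ℝ) (x : PhaseSpace 1) :
    P.generator 1 T_L T_R (testFn P.γ ξ R) x =
      P.γ * (T_L + T_R) *
          (deriv (deriv (phiR ξ R)) (2 * P.γ * x.1 0 + x.2 0) * psiR R (x.2 0) +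
            2 * (deriv (phiR ξ R) (2 * P.γ * x.1 0 + x.2 0) * deriv (psiR R) (x.2 0)) +
              phiR ξ R (2 * P.γ * x.1 0 + x.2 0) * deriv (deriv (psiR R)) (x.2 0)) -
        2 * P.γ * x.2 0 * (phiR ξ R (2 * P.γ * x.1 0 + x.2 0) * deriv (psiR R) (x.2 0)) :=
  generator_one_prodFn P hU (phiR_smooth ξ R) (psiR_smooth R) T_L T_R x

/-- `L F_{ξ,R}` is continuous in `x` (explicit formula). [folklore] -/
theorem continuous_generator_testFn (hU : ∀ q, deriv P.U q = 0) (ξ R T_L T_R : ℝ) :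
    Continuous fun x => P.generator 1 T_L T_R (testFn P.γ ξ R) x := by
  simp only [generator_testFn P hU]
  have hm := continuous_freeMode P.γ
  have hp := continuous_momentum
  have hφ : Continuous (phiR ξ R) := (phiR_smooth ξ R).continuous
  have hφ' : Continuous (deriv (phiR ξ R)) := (phiR_smooth ξ R).continuous_deriv (by simp)
  have hφ'' : Continuous (deriv (deriv (phiR ξ R))) :=
    (contDiff_infty_iff_deriv.mp (phiR_smooth ξ R)).2.continuous_deriv (by simp)
  have hψ : Continuous (psiR R) := (psiR_smooth R).continuous
  have hψ' : Continuous (deriv (psiR R)) := (psiR_smooth R).continuous_deriv (by simp)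
  have hψ'' : Continuous (deriv (deriv (psiR R))) :=
    (contDiff_infty_iff_deriv.mp (psiR_smooth R)).2.continuous_deriv (by simp)
  exact (continuous_const.mul ((((hφ''.comp hm).mul (hψ.comp hp)).add
    (continuous_const.mul ((hφ'.comp hm).mul (hψ'.comp hp)))).add
      ((hφ.comp hm).mul (hψ''.comp hp)))).sub
    ((continuous_const.mul hp).mul ((hφ.comp hm).mul (hψ'.comp hp)))

/-- The uniform bound on `L F_{ξ,R}`, `R ≥ 1`. [folklore] -/
def genBound (γ ξ T_L T_R : ℝ) : ℝ :=
  |γ * (T_L + T_R)| * ((ξ ^ 2 + 2 * |ξ| * derivBound + derivBound) +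
      2 * ((|ξ| + derivBound) * derivBound) + derivBound) +
    |2 * γ| * (2 * derivBound)

/-- `|L F_{ξ,R}| ≤ K(γ, ξ, T_L, T_R)` uniformly in `x` and `R ≥ 1`. [folklore] -/
theorem abs_generator_testFn_le (hU : ∀ q, deriv P.U q = 0) (ξ : ℝ) {R : ℝ} (hR : 1 ≤ R)
    (T_L T_R : ℝ) (x : PhaseSpace 1) :
    |P.generator 1 T_L T_R (testFn P.γ ξ R) x| ≤ genBound P.γ ξ T_L T_R := by
  rw [generator_testFn P hU]
  set m := 2 * P.γ * x.1 0 + x.2 0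
  set p := x.2 0
  have hD := derivBound_nonneg
  have b1 := abs_deriv_deriv_phiR_le ξ hR m
  have b2 := abs_psiR_le R p
  have b3 := abs_deriv_phiR_le ξ hR m
  have b4 := abs_deriv_psiR_le hR p
  have b5 := abs_phiR_le ξ R m
  have b6 := abs_deriv_deriv_psiR_le hR p
  have b7 := abs_mul_deriv_psiR_le hR p
  have hS : |deriv (deriv (phiR ξ R)) m * psiR R p +
        2 * (deriv (phiR ξ R) m * deriv (psiR R) p) + phiR ξ R m * deriv (deriv (psiR R)) p| ≤
      (ξ ^ 2 + 2 * |ξ| * derivBound + derivBound) +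
        2 * ((|ξ| + derivBound) * derivBound) + derivBound := by
    refine le_trans (absAdd_le _ _) (add_le_add (le_trans (absAdd_le _ _) (add_le_add ?_ ?_)) ?_)
    · rw [abs_mul]
      calc |deriv (deriv (phiR ξ R)) m| * |psiR R p|
          ≤ (ξ ^ 2 + 2 * |ξ| * derivBound + derivBound) * 1 := by gcongr
        _ = _ := mul_one _
    · rw [abs_mul, abs_two, abs_mul]
      gcongr
    · rw [abs_mul]
      calc |phiR ξ R m| * |deriv (deriv (psiR R)) p| ≤ 1 * derivBound := by gcongr
        _ = _ := one_mul _
  have hT : |2 * P.γ * p * (phiR ξ R m * deriv (psiR R) p)| ≤ |2 * P.γ| * (2 * derivBound) := by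
    have : 2 * P.γ * p * (phiR ξ R m * deriv (psiR R) p) =
        (2 * P.γ) * (phiR ξ R m * (p * deriv (psiR R) p)) := by ring
    rw [this, abs_mul (2 * P.γ), abs_mul (phiR ξ R m)]
    refine mul_le_mul_of_nonneg_left ?_ (abs_nonneg _)
    calc |phiR ξ R m| * |p * deriv (psiR R) p| ≤ 1 * (2 * derivBound) :=
          mul_le_mul b5 b7 (abs_nonneg _) zero_le_one
      _ = _ := one_mul _
  refine le_trans (absSub_le _ _) (add_le_add ?_ hT)
  rw [abs_mul]
  gcongr

/-- Pointwise limit `L F_{ξ,R}(x) → -γ(T_L + T_R) ξ² cos(ξ m(x))` as `R → ∞`. [folklore] -/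
theorem tendsto_generator_testFn (hU : ∀ q, deriv P.U q = 0) (ξ T_L T_R : ℝ) (x : PhaseSpace 1) :
    Tendsto (fun R => P.generator 1 T_L T_R (testFn P.γ ξ R) x) atTop
      (𝓝 (-(P.γ * (T_L + T_R) * ξ ^ 2 * Real.cos (ξ * (2 * P.γ * x.1 0 + x.2 0))))) := by
  simp only [generator_testFn P hU]
  set m := 2 * P.γ * x.1 0 + x.2 0
  set p := x.2 0
  have h := (((tendsto_deriv_deriv_phiR ξ m).mul (tendsto_psiR p)).add
    ((tendsto_const_nhds (x := (2 : ℝ))).mul ((tendsto_deriv_phiR ξ m).mul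
      (tendsto_deriv_psiR p)))).add ((tendsto_phiR ξ m).mul (tendsto_deriv_deriv_psiR p))
  have h2 := ((tendsto_const_nhds (x := P.γ * (T_L + T_R))).mul h).sub
    ((tendsto_const_nhds (x := 2 * P.γ * p)).mul ((tendsto_phiR ξ m).mul (tendsto_deriv_psiR p)))
  have heq : P.γ * (T_L + T_R) * (-ξ ^ 2 * Real.cos (ξ * m) * 1 +
        2 * (-ξ * Real.sin (ξ * m) * 0) + Real.cos (ξ * m) * 0) -
      2 * P.γ * p * (Real.cos (ξ * m) * 0) =
      -(P.γ * (T_L + T_R) * ξ ^ 2 * Real.cos (ξ * m)) := by ring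
  rw [heq] at h2
  exact h2

end Unpinned

open Unpinned

/-- **Stationarity tested on `F_{ξ,R}`, `R → ∞`: `∫ cos(ξ(2γq + p)) dμ = 0` for every weak steady
state of an unpinned one-site chain and every `ξ ≠ 0`** (dominated convergence; `γ ≠ 0`,
`T_L + T_R ≠ 0`). [folklore] -/
theorem integral_cos_freeMode_eq_zero (hU : ∀ q, deriv P.U q = 0) (hγ : P.γ ≠ 0) {T_L T_R : ℝ}
    (hT : T_L + T_R ≠ 0) {μ : Measure (PhaseSpace 1)} (hμ : P.IsSteadyState 1 T_L T_R μ) {ξ : ℝ}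
    (hξ : ξ ≠ 0) : ∫ x, Real.cos (ξ * (2 * P.γ * x.1 0 + x.2 0)) ∂μ = 0 := by
  obtain ⟨hprob, hstat, -⟩ := hμ
  have h0 : ∀ R, 0 < R → ∫ x, P.generator 1 T_L T_R (testFn P.γ ξ R) x ∂μ = 0 := fun R hR =>
    hstat _ (testFn_smooth P.γ ξ R) (hasCompactSupport_testFn hγ ξ hR)
  have hlim : Tendsto (fun R => ∫ x, P.generator 1 T_L T_R (testFn P.γ ξ R) x ∂μ) atTop
      (𝓝 (∫ x, -(P.γ * (T_L + T_R) * ξ ^ 2 * Real.cos (ξ * (2 * P.γ * x.1 0 + x.2 0))) ∂μ)) := by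
    refine tendsto_integral_filter_of_dominated_convergence (fun _ => genBound P.γ ξ T_L T_R)
      ?_ ?_ (integrable_const _) ?_
    · exact Eventually.of_forall fun R =>
        (continuous_generator_testFn P hU ξ R T_L T_R).aestronglyMeasurable
    · filter_upwards [eventually_ge_atTop (1 : ℝ)] with R hR
      exact Eventually.of_forall fun x => by
        rw [Real.norm_eq_abs]; exact abs_generator_testFn_le P hU ξ hR T_L T_R x
    · exact Eventually.of_forall fun x => tendsto_generator_testFn P hU ξ T_L T_R x
  have hzero : Tendsto (fun R => ∫ x, P.generator 1 T_L T_R (testFn P.γ ξ R) x ∂μ) atTop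
      (𝓝 0) := by
    refine tendsto_const_nhds.congr' ?_
    filter_upwards [eventually_gt_atTop (0 : ℝ)] with R hR
    exact (h0 R hR).symm
  have heq := tendsto_nhds_unique hlim hzero
  rw [integral_neg, integral_const_mul, neg_eq_zero, mul_eq_zero] at heq
  rcases heq with h | h
  · exfalso
    exact mul_ne_zero (mul_ne_zero hγ hT) (pow_ne_zero 2 hξ) h
  · exact h

/-- **An unpinned one-site Langevin chain has no weak steady state** (`U' ≡ 0`, `γ ≠ 0`,
`T_L + T_R ≠ 0`): by `integral_cos_freeMode_eq_zero`, `∫ cos(ξm) dμ = 0` for all `ξ ≠ 0`, and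
`ξ → 0` gives `μ(phase space) = 0`, not `1`. Physically: `m = 2γq + p` is a driftless Brownian
motion (`L(g∘m) = γ(T_L + T_R) g''∘m`), the free particle's position is not confined, so no
stationary probability measure exists. [folklore] -/
theorem not_isSteadyState_one_of_unpinned (hU : ∀ q, deriv P.U q = 0) (hγ : P.γ ≠ 0)
    {T_L T_R : ℝ} (hT : T_L + T_R ≠ 0) (μ : Measure (PhaseSpace 1)) :
    ¬ P.IsSteadyState 1 T_L T_R μ := by
  intro hμ
  haveI := hμ.1
  set F : ℕ → PhaseSpace 1 → ℝ := fun n x =>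
    Real.cos ((1 / ((n : ℝ) + 1)) * (2 * P.γ * x.1 0 + x.2 0)) with hF
  have hcos : ∀ n : ℕ, ∫ x, F n x ∂μ = 0 := fun n =>
    integral_cos_freeMode_eq_zero P hU hγ hT hμ (by positivity)
  have hlim : Tendsto (fun n : ℕ => ∫ x, F n x ∂μ) atTop (𝓝 (∫ _x, (1 : ℝ) ∂μ)) := by
    refine tendsto_integral_of_dominated_convergence (fun _ => (1 : ℝ)) ?_ (integrable_const _) ?_ ?_
    · intro n
      exact (Continuous.aestronglyMeasurable (by
        simp only [hF]
        exact Real.continuous_cos.comp (continuous_const.mul (continuous_freeMode P.γ))))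
    · intro n
      exact Eventually.of_forall fun x => by
        simpa [hF, Real.norm_eq_abs] using Real.abs_cos_le_one _
    · refine Eventually.of_forall fun x => ?_
      have h1 : Tendsto (fun n : ℕ => (1 / ((n : ℝ) + 1)) * (2 * P.γ * x.1 0 + x.2 0)) atTop
          (𝓝 (0 * (2 * P.γ * x.1 0 + x.2 0))) :=
        tendsto_one_div_add_atTop_nhds_zero_nat.mul tendsto_const_nhds
      have h2 := (Real.continuous_cos.tendsto _).comp h1
      simpa [hF, Function.comp_def] using h2
  have h1 : (∫ _x, (1 : ℝ) ∂μ) = 1 := by simp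
  rw [h1] at hlim
  have h0 : Tendsto (fun n : ℕ => ∫ x, F n x ∂μ) atTop (𝓝 0) := by
    simp only [hcos]; exact tendsto_const_nhds
  exact zero_ne_one (tendsto_nhds_unique h0 hlim)

/-- Without baths (`γ = 0`) every rest point `(q, p) = (a, 0)` of the unpinned one-site chain
carries a weak steady state `δ_{(a,0)}` — uniqueness fails instead of existence. [folklore] -/
theorem isSteadyState_dirac_of_unpinned (hU : ∀ q, deriv P.U q = 0) (hγ : P.γ = 0)
    (T_L T_R a : ℝ) :
    P.IsSteadyState 1 T_L T_R (Measure.dirac ((fun _ => a, fun _ => 0) : PhaseSpace 1)) := by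
  refine ⟨inferInstance, ?_, ?_⟩
  · intro f _ _
    rw [integral_dirac, generator_one, partialQ_hamiltonian_one, hU, hγ]
    simp
  · intro i
    have h : P.bondCurrent 1 i = fun _ => 0 := by
      funext x
      simp [OscillatorChain.bondCurrent]
    rw [h]
    exact integrable_zero _ _ _

/-- **No unpinned chain satisfies `FouriersLawFor`.** If the pinning exerts no force
(`U' ≡ 0`: `U = 0`, or any constant) then clause (i) of
`OscillatorChain.FouriersLawFor` — existence AND uniqueness of the weak steady state for every
length `N` and all `T_L, T_R > 0` — fails at `N = 1`: for `γ ≠ 0` there is no steady state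
(`not_isSteadyState_one_of_unpinned`), for `γ = 0` there are two (`isSteadyState_dirac_of_unpinned`).
The same free mode `γ(q_0 + q_{N-1}) + ∑ p_i` rules out steady states at every `N ≥ 1`
(informal; only `N = 1` is used). This is a statement about the tree's encoding (positions in
`ℝ^N`, free ends, baths acting on momenta), NOT about transport: it holds for the FPU-`β` chain,
the Toda chain, the harmonic unpinned chain and every other `OscillatorChain` with `U' ≡ 0`,
whatever its conductivity. [folklore] -/
theorem not_fouriersLawFor_of_unpinned (hU : ∀ q, deriv P.U q = 0) : ¬ P.FouriersLawFor := by
  rintro ⟨hex, -⟩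
  obtain ⟨μ, hμ, huniq⟩ := hex 1 1 1 one_pos one_pos
  by_cases hγ : P.γ = 0
  · have h0 := huniq _ (isSteadyState_dirac_of_unpinned P hU hγ 1 1 0)
    have h1 := huniq _ (isSteadyState_dirac_of_unpinned P hU hγ 1 1 1)
    have heq := h0.trans h1.symm
    have hmem := congrArg (fun ν : Measure (PhaseSpace 1) =>
      ν {((fun _ => (0 : ℝ), fun _ => (0 : ℝ)) : PhaseSpace 1)}) heq
    simp only [Measure.dirac_apply_of_mem (mem_singleton _)] at hmem
    rw [Measure.dirac_apply' _ (measurableSet_singleton _), Set.indicator_of_notMem] at hmem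
    · exact one_ne_zero hmem
    · intro h
      have h' := congrFun (congrArg Prod.fst (mem_singleton_iff.mp h)) 0
      norm_num at h'
  · exact not_isSteadyState_one_of_unpinned P hU hγ (by norm_num) μ hμ

/-- **The FPU-`β` chain of this entry violates `FouriersLawFor` outright** (`U = 0`): the
catalogued technique class's formal target `OscillatorChain.FouriersLawFor (fpuBetaChain β γ)` is
false for every `β, γ`, by translation invariance, independently of any transport anomaly.
[folklore] -/
theorem not_fouriersLawFor_fpuBetaChain (β γ : ℝ) : ¬ (fpuBetaChain β γ).FouriersLawFor :=
  not_fouriersLawFor_of_unpinned _ fun q => by simp [fpuBetaChain]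

/-- The same for the conjunct's family with the pinning switched off, `pinnedChain 0 0 β γ`
(`U(q) = 0·q²/2 + 0·q⁴/4`). [folklore] -/
theorem not_fouriersLawFor_pinnedChain_zero_zero (β γ : ℝ) :
    ¬ (pinnedChain 0 0 β γ).FouriersLawFor :=
  not_fouriersLawFor_of_unpinned _ fun q => by simp [pinnedChain]

end Literature.Barriers.AtomisticToContinuum.HeatConduction
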